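import Mathlib
import HarnessLib
import Literature.MathematicalPhysics.StatisticalMechanics.LennardJonesClusters
import Summits.AtomisticToContinuum.Crystallization.Theorems.ContactSaturationLadderChunkDoor

/-!
# ContactSaturationLadderToleranceFloor — part A (§1 LEMMA A, def-free): GRADED COMPRESSION EXCLUSION in Lennard-Jones ground states

lens-1 g31 land twin `ContactSaturationLadderToleranceFloor.lean` (sha256 07d5e41e…; lineage node `LooseTextureRung_node_g31.lean` §41
«FloorRebase41»; helper beneath the residual `NoLooseChunks` of crux `LooseTextureRung`, stmt-AtomisticToContinuum-30303, route
`ContactSaturationLadder`), SPLIT at the gate's 400-line cap by hand-2 g8 (critic row 405 (5)): part A = the twin's §1 VERBATIM (namespace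
unchanged, so every FQN is the twin's); part B (`ContactSaturationLadderToleranceFloor.lean`) = §2–§5.  The twin's description of §1:

§1 **LEMMA A — graded compression exclusion (DEF-FREE).**  `card_within_lt_of_capacity`: in a Lennard-Jones ground state, for `ρ ≤ 1` and
   `n·(ρ⁻¹² − 2ρ⁻⁶) > (84/25)/(7/20)³ − 1 ≈ 77.37`, FEWER THAN `n` other particles lie within distance `ρ` of any particle; grades
   `< 12` within `4/5`, `< 8` within `39/50`, `< 4` within `3/4`, `< 3` within `18/25`; and `four_fifths_lt_of_twelve_contacts`: twelve particles
   within `(1+δ)·d` of a ground-state particle force `(1+δ)·d > 4/5`.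
   Proof (removal + charged capacity, all inputs in the tree): `LjLaminarWindowsSketch.forceBalance_one_le_sum_hLJ` gives
   `∑_{k≠j} h(|y_j−y_k|) ≥ 1` (`h = hLJ = −12·V_LJ`); the `k` within `ρ` contribute `≤ h(ρ) = 2ρ⁻⁶ − ρ⁻¹² < 0` each (`h` increases on `(0,1]`),
   the rest `≤ ∑ kF ≤ (84/25)/(7/20)³` by `ForceCapacity` (`stub_forceCapacity stub_forceTheta stub_forceClubsuit`) at `c = 7/20`, admissible
   because ground states are `7/10`-separated (`lennardJones_groundState_dist_ge_seven_tenths`).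

Every statement below is PROVED (0 sorry, standard axioms).
-/

noncomputable section

namespace Summit.AtomisticToContinuum.Crystallization.Theorems.ContactSaturationLadderToleranceFloor

open scoped BigOperators Classical
open Metric
open Literature.MathematicalPhysics.StatisticalMechanics (lennardJones IsGroundState)
open Literature.MathematicalPhysics.StatisticalMechanics.Yuhjtman2015 (hLJ)
open Summit.AtomisticToContinuum.Crystallization.Theorems
open Summit.AtomisticToContinuum.Crystallization.Theorems.ContactSaturationLadderHaloCount (UniformlyTight looseSet voidAdjSet)
open Summit.AtomisticToContinuum.Crystallization.Theorems.ContactSaturationLadderChunkDoor (NoLooseChunkAt NoLooseChunks)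
open Summit.AtomisticToContinuum.Crystallization.Theorems.ContactSaturationLadderDensityFloor (card_window_ge_of_not_voidAdj)
open Summit.AtomisticToContinuum.Crystallization.Theorems.LjLaminarWindowsSketch (hLJ' kF ForceCapacity stub_forceCapacity
  stub_forceTheta stub_forceClubsuit forceBalance_one_le_sum_hLJ lennardJones_groundState_dist_ge_seven_tenths)

/-! ## §1 LEMMA A — graded compression exclusion (def-free) -/

/-- `h = hLJ` is INCREASING on `(0,1]`: `h(v) ≤ h(ρ)` for `0 < v ≤ ρ ≤ 1` (`h = 1 − (u−1)²`, `u = v⁻⁶ ≥ ρ⁻⁶ ≥ 1`). [folklore] -/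
theorem hLJ_le_hLJ_of_le_of_le_one {v ρ : ℝ} (hv : 0 < v) (hvρ : v ≤ ρ) (hρ : ρ ≤ 1) : hLJ v ≤ hLJ ρ := by
  unfold hLJ
  have hρ0 : 0 < ρ := lt_of_lt_of_le hv hvρ
  have h1 : 1 ≤ ρ⁻¹ := (one_le_inv₀ hρ0).2 hρ
  have h2 : ρ⁻¹ ≤ v⁻¹ := inv_anti₀ hv hvρ
  have hu₀ : 1 ≤ ρ⁻¹ ^ 6 := one_le_pow₀ h1
  have hu : ρ⁻¹ ^ 6 ≤ v⁻¹ ^ 6 := pow_le_pow_left₀ (le_trans zero_le_one h1) h2 6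
  have e1 : v⁻¹ ^ 12 = (v⁻¹ ^ 6) ^ 2 := by ring
  have e2 : ρ⁻¹ ^ 12 = (ρ⁻¹ ^ 6) ^ 2 := by ring
  rw [e1, e2]
  nlinarith [mul_nonneg (sub_nonneg.2 hu) (by linarith : (0 : ℝ) ≤ v⁻¹ ^ 6 + ρ⁻¹ ^ 6 - 2)]

/-- The charged minus-energy dominates the minus-energy: `h ≤ kF = h + (1/25)|h'|`. [folklore] -/
theorem hLJ_le_kF (v : ℝ) : hLJ v ≤ kF v := by
  unfold kF
  have := abs_nonneg (hLJ' v)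
  linarith

/-- **LEMMA A (general grade).**  In a Lennard-Jones ground state, for `ρ ≤ 1` and `n` with `n·(ρ⁻¹² − 2ρ⁻⁶) > (84/25)/(7/20)³ − 1`, FEWER
THAN `n` other particles lie within distance `ρ` of any particle `y j`. [folklore] -/
theorem card_within_lt_of_capacity {N : ℕ} {y : Fin N → EuclideanSpace ℝ (Fin 3)} (hy : IsGroundState lennardJones y)
    (j : Fin N) {ρ : ℝ} (hρ1 : ρ ≤ 1) {n : ℕ}
    (hn : 84 / 25 / (7 / 20 : ℝ) ^ 3 - 1 < n * (ρ⁻¹ ^ 12 - 2 * ρ⁻¹ ^ 6)) :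
    (Finset.univ.filter fun l : Fin N => l ≠ j ∧ dist (y l) (y j) ≤ ρ).card < n := by
  by_contra hcon
  rw [not_lt] at hcon
  set T : Finset (Fin N) := Finset.univ.filter fun l : Fin N => l ≠ j ∧ dist (y l) (y j) ≤ ρ with hT
  have hn' : 84 / 25 / (7 / 20 : ℝ) ^ 3 - 1 < -((n : ℝ) * hLJ ρ) := by
    rw [← mul_neg]
    unfold hLJ
    rw [neg_sub]
    exact hn
  have hcap : (0 : ℝ) < 84 / 25 / (7 / 20 : ℝ) ^ 3 - 1 := by norm_num
  have hn0 : (0 : ℝ) ≤ n := Nat.cast_nonneg n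
  have hneg : hLJ ρ < 0 := by
    by_contra hge
    rw [not_lt] at hge
    have : 0 ≤ (n : ℝ) * hLJ ρ := mul_nonneg hn0 hge
    linarith
  have hnpos : (0 : ℝ) < n := by
    rcases Nat.eq_zero_or_pos n with h0 | h0
    · exfalso
      rw [h0] at hn'
      simp at hn'
      linarith
    · exact_mod_cast h0
  have hconR : (n : ℝ) ≤ T.card := by exact_mod_cast hcon
  have hTpos : 0 < T.card := by
    have : (0 : ℝ) < T.card := lt_of_lt_of_le hnpos hconR
    exact_mod_cast this
  obtain ⟨q, hq⟩ := Finset.card_pos.mp hTpos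
  have hqj : q ≠ j := by
    simp only [hT, Finset.mem_filter, Finset.mem_univ, true_and] at hq
    exact hq.1
  have hfb := forceBalance_one_le_sum_hLJ hy hqj.symm
  have hTS : T ⊆ Finset.univ.erase j := by
    intro l hl
    simp only [hT, Finset.mem_filter, Finset.mem_univ, true_and] at hl
    exact Finset.mem_erase.2 ⟨hl.1, Finset.mem_univ _⟩
  rw [← Finset.sum_sdiff hTS] at hfb
  -- the `≥ n` compressed neighbours contribute `≤ n · h(ρ)`
  have h1 : ∑ k ∈ T, hLJ (dist (y j) (y k)) ≤ T.card * hLJ ρ := by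
    have : ∑ k ∈ T, hLJ (dist (y j) (y k)) ≤ ∑ _k ∈ T, hLJ ρ := by
      apply Finset.sum_le_sum
      intro k hk
      simp only [hT, Finset.mem_filter, Finset.mem_univ, true_and] at hk
      have hpos : 0 < dist (y j) (y k) := by
        have := lennardJones_groundState_dist_ge_seven_tenths hy hk.1.symm
        linarith
      exact hLJ_le_hLJ_of_le_of_le_one hpos (by rw [dist_comm]; exact hk.2) hρ1
    rwa [Finset.sum_const, nsmul_eq_mul] at this
  have h1' : (T.card : ℝ) * hLJ ρ ≤ n * hLJ ρ := mul_le_mul_of_nonpos_right hconR hneg.le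
  -- the other neighbours are `7/10`-separated from `y j` and pairwise: charged capacity at `c = 7/20`
  have h2 : ∑ k ∈ Finset.univ.erase j \ T, hLJ (dist (y j) (y k)) ≤ 84 / 25 / (7 / 20 : ℝ) ^ 3 := by
    have hFC : ForceCapacity := stub_forceCapacity stub_forceTheta stub_forceClubsuit
    have hcapS := hFC N (Finset.univ.erase j \ T) (fun k => y k - y j) (7 / 20) (by norm_num) (by norm_num)
      (by
        intro k hk
        rw [Finset.mem_sdiff, Finset.mem_erase] at hk
        have h7 := lennardJones_groundState_dist_ge_seven_tenths hy hk.1.1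
        rw [dist_eq_norm] at h7
        linarith)
      (by
        intro i hi k hk hik
        have h7 := lennardJones_groundState_dist_ge_seven_tenths hy hik
        have e : dist (y i - y j) (y k - y j) = dist (y i) (y k) := by
          rw [dist_eq_norm, dist_eq_norm]
          congr 1
          abel
        rw [e]
        linarith)
    refine le_trans (Finset.sum_le_sum fun k _ => ?_) hcapS
    have e : dist (y j) (y k) = ‖y k - y j‖ := by rw [dist_comm, dist_eq_norm]
    rw [e]
    exact hLJ_le_kF _
  have : (1 : ℝ) < 1 :=
    calc (1 : ℝ) ≤ ∑ k ∈ Finset.univ.erase j \ T, hLJ (dist (y j) (y k)) + ∑ k ∈ T, hLJ (dist (y j) (y k)) := hfb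
      _ ≤ 84 / 25 / (7 / 20 : ℝ) ^ 3 + n * hLJ ρ := by linarith
      _ < 1 := by linarith
  exact lt_irrefl _ this

/-- **LEMMA A at the route's grade.**  No Lennard-Jones ground-state particle has twelve other particles within distance `4/5`
(`12·6.92 = 83.07 > 77.37`). [folklore] -/
theorem card_within_four_fifths_lt_twelve {N : ℕ} {y : Fin N → EuclideanSpace ℝ (Fin 3)} (hy : IsGroundState lennardJones y)
    (j : Fin N) : (Finset.univ.filter fun l : Fin N => l ≠ j ∧ dist (y l) (y j) ≤ 4 / 5).card < 12 :=
  card_within_lt_of_capacity hy j (by norm_num) (by norm_num)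

/-- Further grades of Lemma A: fewer than 8 others within `39/50`. [folklore] -/
theorem card_within_lt_eight {N : ℕ} {y : Fin N → EuclideanSpace ℝ (Fin 3)} (hy : IsGroundState lennardJones y)
    (j : Fin N) : (Finset.univ.filter fun l : Fin N => l ≠ j ∧ dist (y l) (y j) ≤ 39 / 50).card < 8 :=
  card_within_lt_of_capacity hy j (by norm_num) (by norm_num)

/-- Further grades of Lemma A: fewer than 4 others within `3/4`. [folklore] -/
theorem card_within_three_quarters_lt_four {N : ℕ} {y : Fin N → EuclideanSpace ℝ (Fin 3)} (hy : IsGroundState lennardJones y)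
    (j : Fin N) : (Finset.univ.filter fun l : Fin N => l ≠ j ∧ dist (y l) (y j) ≤ 3 / 4).card < 4 :=
  card_within_lt_of_capacity hy j (by norm_num) (by norm_num)

/-- Further grades of Lemma A: fewer than 3 others within `18/25`. [folklore] -/
theorem card_within_lt_three {N : ℕ} {y : Fin N → EuclideanSpace ℝ (Fin 3)} (hy : IsGroundState lennardJones y)
    (j : Fin N) : (Finset.univ.filter fun l : Fin N => l ≠ j ∧ dist (y l) (y j) ≤ 18 / 25).card < 3 :=
  card_within_lt_of_capacity hy j (by norm_num) (by norm_num)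

/-- **Consequence for the twelve-contact inequality.**  In a ground state, twelve particles within `(1+δ)·d` of a particle force
`(1+δ)·d > 4/5`. [folklore] -/
theorem four_fifths_lt_of_twelve_contacts {N : ℕ} {y : Fin N → EuclideanSpace ℝ (Fin 3)} (hy : IsGroundState lennardJones y)
    {j : Fin N} {δ d : ℝ} (h12 : 12 ≤ (Finset.univ.filter fun l : Fin N => l ≠ j ∧ dist (y l) (y j) ≤ (1 + δ) * d).card) :
    4 / 5 < (1 + δ) * d := by
  by_contra hle
  rw [not_lt] at hle
  have hsub : (Finset.univ.filter fun l : Fin N => l ≠ j ∧ dist (y l) (y j) ≤ (1 + δ) * d) ⊆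
      (Finset.univ.filter fun l : Fin N => l ≠ j ∧ dist (y l) (y j) ≤ 4 / 5) := by
    intro l hl
    simp only [Finset.mem_filter, Finset.mem_univ, true_and] at hl ⊢
    exact ⟨hl.1, le_trans hl.2 hle⟩
  have := Finset.card_le_card hsub
  have := card_within_four_fifths_lt_twelve hy j
  omega

end Summit.AtomisticToContinuum.Crystallization.Theorems.ContactSaturationLadderToleranceFloor

end
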